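import Literature.AlgebraicGeometry.Frobenioids.NumberFieldLocalizationCategoriesProofs
import HarnessLib

/-!
# Frobenioids II, Example 1.4 (ii): the `Aut`-bijection `Aut_{E₀}(E₀) ⥲ Aut_{P₀}(P₀)` HOLDS for abelian `G`

Mochizuki, *The geometry of Frobenioids II: poly-Frobenioids*, Kyushu J. Math. **62** (2008)
401–460, §1, Example 1.4 (ii), author's text p. 13 (kurims `paper:url-4322d76898e0`): "if
`E₀ ∈ Ob(E₀)` projects to `P₀ ∈ Ob(P₀)`, then `E₀ → P₀` induces a bijection
`Aut_{E₀}(E₀) ⥲ Aut_{P₀}(P₀)`" [cite: MochizukiFrdII2008, Ex. 1.4 (ii) p.13].  The statement file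
`NumberFieldLocalizationCategories.lean` (abc-iut-L1-t8) types this AS PRINTED as the named statement
`NFLocCat.AutBijective G D` (over a topological group `G = Gal(F̃/F)` and a subgroup `D = D_v`);
its injectivity half is a theorem (`NFLocCat.autBijective_injective`) and its surjectivity half is
REFUTED at `(G, D) = (S₃, A₃)` (`NFLocCat.not_autBijective_perm_fin_three`, seat abc-iut-L1-d9).

This PROOF-ONLY file (no definition, no named fact; seat abc-iut-w5-d174, sub-DAG W1 follow-up to
`NumberFieldLocalizationsAutLifting.lean`) kernel-checks the POSITIVE side: **`AutBijective G D`
holds whenever `G` is abelian** (`NFLocCat.autBijective_of_comm`).  Indeed, for an object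
`(P, Q, ι)` of `E₀` (`P` a single `D`-orbit, `Q` a single `G`-orbit, `ι : P ↪ Q|_D`) every
`D`-automorphism of `P` is "translate by some `d ∈ D`" (it is determined by the image of one point,
and `D` is abelian), and "translate by `d`" on `Q` is `G`-equivariant (as `G` is abelian), compatible
with `ι`, hence an automorphism of `(P, Q, ι)` lifting the given one.

Consequences (recorded, no side taken on how the printed sentence should be read in general):
together with `NFLocCat.prop15_iv_full_of_autBijective` (`NumberFieldLocalizationsAutLifting.lean`)
this gives [FrdII] Prop. 1.5 (iv) IN FULL — both `Aut`-bijections and both "if and only if"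
clauses — for every ABELIAN profinite `G` and every `D`; the failure of the printed `Aut`-bijection
(the typer's erratum candidate E2) is thus a genuinely NON-ABELIAN phenomenon (`(S₃, A₃)`).
Refereed pre-IUT material; nothing here bears on [IUTchIII] Cor. 3.12.
-/

namespace Literature.AlgebraicGeometry.Frobenioids

namespace NFLocCat

open CategoryTheory
open scoped FintypeCatDiscrete

universe u

variable {G : Type u} [CommGroup G] [TopologicalSpace G] [IsTopologicalGroup G] (D : Subgroup G)

omit [IsTopologicalGroup G] in
/-- **"Translate by `g`" is an automorphism of every object of `B(G)` when `G` is abelian**: the map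
`x ↦ g • x` is `G`-equivariant. [cite: MochizukiFrdII2008, Ex. 1.4 (ii) p.13] -/
theorem exists_translate_hom (Y : BCat G) (g : G) :
    ∃ t : Y ⟶ Y, IsIso t ∧ ∀ x : Y.obj.V, t.hom.hom x = g • x := by
  let t : Y ⟶ Y := ObjectProperty.homMk
    { hom := FintypeCat.homMk fun x : Y.obj.V => g • x
      comm := fun h => by
        apply FintypeCat.hom_ext
        intro x
        simp only [FintypeCat.comp_apply, FintypeCat.homMk_apply]
        change g • (h • x) = h • (g • x)
        rw [smul_smul, smul_smul, mul_comm] }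
  have ht : ∀ x : Y.obj.V, t.hom.hom x = g • x := fun x => by
    change (FintypeCat.homMk fun x : Y.obj.V => g • x) x = g • x
    rw [FintypeCat.homMk_apply]
  refine ⟨t, BCat.isIso_of_bijective t ?_, ht⟩
  have : (fun x : Y.obj.V => t.hom.hom x) = fun x => g • x := funext ht
  change Function.Bijective fun x : Y.obj.V => t.hom.hom x
  rw [this]
  exact MulAction.bijective g

/-- **[FrdII] Example 1.4 (ii), the `Aut`-bijection `Aut_{E₀}(P, Q, ι) ⥲ Aut_{P₀}(P)`, HOLDS for
ABELIAN `G`** (any topological abelian group `G`, any subgroup `D`): every automorphism of the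
`P`-component lifts.  Compare `not_autBijective_perm_fin_three` (it FAILS for `(S₃, A₃)`).
[cite: MochizukiFrdII2008, Ex. 1.4 (ii) p.13] -/
theorem autBijective_of_comm : AutBijective G D := by
  intro T
  refine ⟨autBijective_injective D T, fun a => ?_⟩
  -- notation: `T = (P, Q, ι)`, a base point `p₀ ∈ P`
  obtain ⟨p₀⟩ := nonempty_left D T
  -- the given automorphism of `P` moves `p₀` to `d • p₀` for some `d ∈ D` (`P` is one `D`-orbit)
  obtain ⟨d, hd⟩ := BCat.exists_smul_eq_of_isConnectedObj T.obj.left.obj T.obj.left.property p₀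
    (a.hom.hom.hom.hom p₀)
  -- "translate by `d`" on `P` (a `D`-morphism, `D` abelian) and on `Q` (a `G`-morphism, `G` abelian)
  obtain ⟨s, hsIso, hs⟩ := exists_translate_hom (G := D) T.obj.left.obj d
  obtain ⟨t, htIso, ht⟩ := exists_translate_hom T.obj.right.obj (d : G)
  -- the given automorphism IS "translate by `d`" (both agree at `p₀`, `P` connected)
  have ha : a.hom.hom = s :=
    BCat.hom_eq_of_apply_eq T.obj.left.property p₀ (hd.symm.trans (hs p₀).symm)
  -- compatibility with `ι`: `ι (d • x) = d • ι x`
  have hw : (connectedObjects (BCat D)).ι.map (ObjectProperty.homMk s : T.obj.left ⟶ T.obj.left) ≫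
      T.obj.hom = T.obj.hom ≫ (rho G D).map (ObjectProperty.homMk t : T.obj.right ⟶ T.obj.right) := by
    apply BCat.hom_ext_apply
    intro x
    change T.obj.hom.hom.hom (s.hom.hom x) = t.hom.hom (T.obj.hom.hom.hom x)
    rw [hs, ht]
    exact BCat.hom_smul (X := T.obj.left.obj) (Y := (res G D).obj T.obj.right.obj) T.obj.hom d x
  -- the lift
  haveI : IsIso s := hsIso
  haveI : IsIso t := htIso
  let sIso : T.obj.left ≅ T.obj.left := (connectedObjects (BCat D)).isoMk (asIso s)
  let tIso : T.obj.right ≅ T.obj.right := (connectedObjects (BCat G)).isoMk (asIso t)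
  let b : Aut T := (isLocalization G D).isoMk (Comma.isoMk sIso tIso hw)
  refine ⟨b, Iso.ext ?_⟩
  change b.hom.hom.left = a.hom
  apply ObjectProperty.hom_ext
  change s = a.hom.hom
  exact ha.symm

end NFLocCat

end Literature.AlgebraicGeometry.Frobenioids
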